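import Literature.NumberTheory.EllipticCurves.TateModuleTwistTransportProofs
import Literature.NumberTheory.EllipticCurves.PotentialGoodReductionInertiaProofs
import HarnessLib

/-!
# `V_ℓ` of a base change and of a quadratic twist as Galois representations (transport proofs)

`Proofs` file (theorems only, no definitions, no named facts) in topic
`NumberTheory/EllipticCurves`, landed bottom-up for the named fact
`WeierstrassCurve.LSeries_baseChange_quadratic` (Ireland–Rosen, *A Classical Introduction to
Modern Number Theory*, Prop. 20.5.4(b): `L(E_K/K, s) = L(E/ℚ, s) L(E^{(d_K)}/ℚ, s)`), whose proof in
the tree goes through the `ℓ`-adic Tate modules: `V_ℓ(E_K) = V_ℓ(E)|_{Γ_K}` and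
`V_ℓ(E^{(D)}) = V_ℓ(E) ⊗ χ_D` as Galois representations.  In the tree the three Tate modules are
built on three different discrete Galois modules (`E(ℚ̄)` with its `Γ_ℚ`-action, `E_K(K̄)` with its
`Γ_K`-action, `E^{(D)}(ℚ̄)`), so these identities are *isomorphisms*, produced here existentially:

* `Literature.NumberTheory.EllipticCurves.exists_rationalTateModule_equiv_of_addEquiv` —
  **functoriality of `V_ℓ`**: an additive isomorphism `e : A ≃+ B` of discrete modules which is
  equivariant along a group homomorphism `r : Γ' → Γ` up to signs `s : Γ' → ℤˣ`
  (`e (r γ • a) = s γ • γ • e a`) induces a `ℚ_ℓ`-linear isomorphism `V_ℓ A ≃ V_ℓ B` with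
  `E (ρ_A (r γ) x) = s γ • ρ_B γ (E x)` (Silverman, *AEC*, III.§7: `T_ℓ` is a functor);
* `WeierstrassCurve.exists_addEquiv_geomPoints_baseChange`,
  `WeierstrassCurve.exists_rationalTateModule_equiv_baseChange` — for `L/K` algebraic,
  `E(K̄) ≃+ E_L(L̄)` and `V_ℓ(E) ≃ V_ℓ(E_L)`, equivariant along the restriction
  `Γ_L → Γ_K` (`absGaloisRestrict`; the tree's `pointsMapOfEmb`, `localPointsEquivGeomPoints`);
* `WeierstrassCurve.exists_addEquiv_geomPoints_quadraticTwist_sign`,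
  `WeierstrassCurve.exists_rationalTateModule_equiv_quadraticTwist` — for `2 ≠ 0` and `d ≠ 0`,
  `E^{(d)}(K̄) ≃+ E(K̄)` with `f(σP) = ± σ f(P)` according to `σ √d = ± √d` (Silverman, *AEC*,
  X.5 Cor. 5.4, X.2 Prop. 2.4; the tree's `untwistEquiv`), hence `V_ℓ(E^{(d)}) ≃ V_ℓ(E)` carrying
  the Galois action to `σ ↦ χ(σ) ρ_E(σ)` for any `χ : Γ_K → ℚ_ℓˣ` with `χ(σ) = ±1` according to
  `σ√d = ±√d` (the quadratic character of `K(√d)/K`).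

## References

* J. H. Silverman, *The Arithmetic of Elliptic Curves*, 2nd ed. (2009), III.§7, VIII.§1, X.2
  Prop. 2.4, X.5 Cor. 5.4. [SilvermanAEC2009]
* J.-P. Serre, *Abelian ℓ-adic representations and elliptic curves* (1968), I §1.2, §2.1.
  [SerreAbelianLadic1968]
-/

noncomputable section

open scoped Classical TensorProduct
open Field

universe u

namespace Literature.NumberTheory.EllipticCurves

/-! ## Functoriality of `V_ℓ` on (twisted-)equivariant additive isomorphisms -/

section Functor

variable {Γ : Type*} {Γ' : Type*} [Group Γ] [Group Γ'] {A : Type u} {B : Type u}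
  [AddCommGroup A] [AddCommGroup B] [DistribMulAction Γ A] [DistribMulAction Γ' B]
  (p : ℕ) [Fact p.Prime]

/-- **`V_ℓ` is a functor: transport of the Galois action along an additive isomorphism.**  Let
`e : A ≃+ B` be an additive isomorphism of discrete modules, `r : Γ' → Γ` a group homomorphism and
`s : Γ' → ℤˣ` signs with `e (r γ • a) = s γ • (γ • e a)` for all `γ ∈ Γ'`, `a ∈ A`.  Then there is
a `ℚ_ℓ`-linear isomorphism `E : V_ℓ A ≃ V_ℓ B` with `E (ρ_A (r γ) x) = s γ • ρ_B γ (E x)`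
(`T_ℓ e` is an isomorphism with inverse `T_ℓ e⁻¹`, and the identity holds coordinatewise on
`T_ℓ = lim A[ℓⁿ]`).  Silverman, *AEC*, III.§7; Serre (1968), I §1.2. [folklore] -/
theorem exists_rationalTateModule_equiv_of_addEquiv (r : Γ' →* Γ) (s : Γ' → ℤˣ) (e : A ≃+ B)
    (he : ∀ (γ : Γ') (a : A), e (r γ • a) = (s γ : ℤ) • (γ • e a)) :
    ∃ E : RationalTateModule A p ≃ₗ[ℚ_[p]] RationalTateModule B p,
      ∀ (γ : Γ') (x : RationalTateModule A p),
        E (rationalTateRepresentation Γ A p (r γ) x) =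
          ((s γ : ℤ) : ℚ_[p]) • rationalTateRepresentation Γ' B p γ (E x) := by
  -- `T_ℓ e` and its inverse
  set T : TateModule A p →ₗ[ℤ_[p]] TateModule B p := TateModule.map p e.toAddMonoidHom with hT
  set T' : TateModule B p →ₗ[ℤ_[p]] TateModule A p := TateModule.map p e.symm.toAddMonoidHom
    with hT'
  have h1 : T'.comp T = LinearMap.id := by
    rw [hT, hT', ← TateModule.map_comp, ← TateModule.map_id (p := p) (A := A)]
    congr 1
    ext a
    exact e.symm_apply_apply a
  have h2 : T.comp T' = LinearMap.id := by
    rw [hT, hT', ← TateModule.map_comp, ← TateModule.map_id (p := p) (A := B)]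
    congr 1
    ext b
    exact e.apply_symm_apply b
  let TE : TateModule A p ≃ₗ[ℤ_[p]] TateModule B p := LinearEquiv.ofLinear T T' h2 h1
  -- equivariance on `T_ℓ`, coordinatewise
  have hTsmul : ∀ (γ : Γ') (x : TateModule A p), T (r γ • x) = (s γ : ℤ) • (γ • T x) := by
    intro γ x
    refine TateModule.ext fun n ↦ ?_
    rw [hT, TateModule.proj_map, TateModule.proj_smul_of_distribMulAction, map_zsmul,
      TateModule.proj_smul_of_distribMulAction, TateModule.proj_map]
    exact he γ _
  refine ⟨TE.baseChange ℤ_[p] ℚ_[p] (TateModule A p) (TateModule B p), fun γ ↦ ?_⟩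
  suffices H : ∀ x : ℚ_[p] ⊗[ℤ_[p]] TateModule A p,
      TE.baseChange ℤ_[p] ℚ_[p] (TateModule A p) (TateModule B p)
          ((tateRepresentation Γ A p (r γ)).baseChange ℚ_[p] x) =
        ((s γ : ℤ) : ℚ_[p]) • (tateRepresentation Γ' B p γ).baseChange ℚ_[p]
          (TE.baseChange ℤ_[p] ℚ_[p] (TateModule A p) (TateModule B p) x) from
    fun x ↦ H x
  intro x
  induction x using TensorProduct.induction_on with
  | zero => simp only [map_zero, smul_zero]
  | tmul c t =>
    simp only [LinearEquiv.baseChange_tmul, LinearMap.baseChange_tmul,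
      tateRepresentation_apply_apply]
    change c ⊗ₜ[ℤ_[p]] T (r γ • t) = ((s γ : ℤ) : ℚ_[p]) • (c ⊗ₜ[ℤ_[p]] (γ • T t))
    rw [hTsmul, ← Int.cast_smul_eq_zsmul ℤ_[p] (s γ : ℤ) (γ • T t), TensorProduct.tmul_smul,
      ← algebraMap_smul ℚ_[p] ((s γ : ℤ) : ℤ_[p]), map_intCast]
  | add x y hx hy => simp only [map_add, smul_add, hx, hy]

end Functor

end Literature.NumberTheory.EllipticCurves

namespace WeierstrassCurve

open Literature.NumberTheory.EllipticCurves Literature.NumberTheory.GaloisRepresentations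

/-! ## `V_ℓ(E_L) ≅ V_ℓ(E)|_{Γ_L}` -/

section BaseChange

variable {K : Type u} [Field K] (W : WeierstrassCurve K) (L : Type u) [Field L] [Algebra K L]
  [Algebra.IsAlgebraic K L]

/-- **`E(K̄) ≃ E_L(L̄)` equivariantly along `Γ_L → Γ_K`.**  For an algebraic extension `L/K` and a
Weierstrass curve `W/K`, the map on points along the chosen `K`-embedding `ι : K̄ → L̄`
(`pointsMapOfEmb`, bijective for `L/K` algebraic) followed by the identification
`E(L̄) = E_L(L̄)` (`localPointsEquivGeomPoints`) is an additive isomorphism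
`e : E(K̄) ≃+ E_L(L̄)` with `e(res γ • P) = γ • e(P)` for `γ ∈ Γ_L`
(`localPointsEquivGeomPoints_pointsMapOfEmb_smul`).  Silverman, *AEC*, VIII.§1. [folklore] -/
theorem exists_addEquiv_geomPoints_baseChange :
    ∃ e : geomPoints W ≃+ geomPoints (W.baseChange L),
      ∀ (γ : absoluteGaloisGroup L) (P : geomPoints W),
        e (absGaloisRestrict K L γ • P) = γ • e P :=
  ⟨(AddEquiv.ofBijective (pointsMapOfEmb W (absClosureEmbedding K L))
      (pointsMapOfEmb_bijective L W _)).trans (localPointsEquivGeomPoints W L),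
    fun γ P ↦ localPointsEquivGeomPoints_pointsMapOfEmb_smul W L γ P⟩

/-- **`V_ℓ(E_L) ≅ V_ℓ(E)|_{Γ_L}`**: for `L/K` algebraic there is a `ℚ_ℓ`-linear isomorphism
`E : V_ℓ(E) ≃ V_ℓ(E_L)` with `E (ρ_E(res γ) x) = ρ_{E_L}(γ) (E x)` for all `γ ∈ Γ_L` — the Tate
module of the base change is the restriction of the Tate module.  Serre (1968), I §1.2;
Silverman, *AEC*, III.§7. [folklore] -/
theorem exists_rationalTateModule_equiv_baseChange (p : ℕ) [Fact p.Prime] :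
    ∃ E : W.rationalTateModule p ≃ₗ[ℚ_[p]] (W.baseChange L).rationalTateModule p,
      ∀ (γ : absoluteGaloisGroup L) (x : W.rationalTateModule p),
        E (W.rationalGaloisRepTate p (absGaloisRestrict K L γ) x) =
          (W.baseChange L).rationalGaloisRepTate p γ (E x) := by
  obtain ⟨e, he⟩ := W.exists_addEquiv_geomPoints_baseChange L
  obtain ⟨E, hE⟩ := exists_rationalTateModule_equiv_of_addEquiv p
    (absGaloisRestrict K L).toMonoidHom (fun _ ↦ 1) e fun γ a ↦ by
      rw [Units.val_one, one_zsmul]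
      exact he γ a
  refine ⟨E, fun γ x ↦ ?_⟩
  have h := hE γ x
  rw [Units.val_one, Int.cast_one, one_smul] at h
  exact h

end BaseChange

/-! ## `V_ℓ(E^{(d)}) ≅ V_ℓ(E) ⊗ χ` -/

section Twist

variable {K : Type u} [Field K] [NeZero (2 : K)]

/-- **`E^{(d)}(K̄) ≃ E(K̄)` with `f(σP) = ±σf(P)` according to `σ√d = ±√d`** (Silverman, *AEC*,
X.5 Cor. 5.4(iii), X.2 Prop. 2.4).  The isomorphism is the one of the tree's
`exists_addEquiv_geomPoints_quadraticTwist` (transport `W^{(d)} = W₀^{(d)}` for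
`W₀ = W.toCharNeTwoNF • W`, untwisting `(x, y) ↦ (x/d, y/d√d)` (`untwistEquiv`), change of
variables back to `W`); its behaviour under `σ` with `σ√d = -√d` is `untwistEquiv_smul_of_eq_neg`.
[cite: SilvermanAEC2009, X.5 Cor. 5.4 and X.2 Prop. 2.4] -/
theorem exists_addEquiv_geomPoints_quadraticTwist_sign (W : WeierstrassCurve K) {d : K}
    (hd : d ≠ 0) :
    ∃ f : (W.quadraticTwist d).geomPoints ≃+ W.geomPoints,
      (∀ σ : absoluteGaloisGroup K, σ • geomSqrt d = geomSqrt d →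
        ∀ P, f (σ • P) = σ • f P) ∧
      (∀ σ : absoluteGaloisGroup K, σ • geomSqrt d = -geomSqrt d →
        ∀ P, f (σ • P) = -(σ • f P)) := by
  letI : Invertible (2 : K) := invertibleOfNonzero two_ne_zero
  set C : VariableChange K := W.toCharNeTwoNF with hC
  set V : WeierstrassCurve K := C • W with hV
  haveI : V.IsCharNeTwoNF := by rw [hV, hC]; infer_instance
  have hVW : W.quadraticTwist d = V.quadraticTwist d := by
    rw [hV, quadraticTwist_smul]
    have h1 : (⟨C.u, d * C.r, 0, 0⟩ : VariableChange K) = 1 := by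
      simp only [hC, toCharNeTwoNF, mul_zero]
      rfl
    rw [h1, one_smul]
  let e₁ : (W.quadraticTwist d).geomPoints ≃+ (V.quadraticTwist d).geomPoints :=
    Affine.Point.congrEquiv
      (congrArg (fun Z : WeierstrassCurve K ↦ Z.baseChange (AlgebraicClosure K)) hVW)
  let e₂ : (V.quadraticTwist d).geomPoints ≃+ V.geomPoints := untwistEquiv V hd
  let e₃ : V.geomPoints ≃+ W.geomPoints :=
    (VariableChange.pointEquivBaseChange W C (AlgebraicClosure K)).symm
  have h₁ : ∀ (σ : absoluteGaloisGroup K) P, e₁ (σ • P) = σ • e₁ P := fun σ P ↦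
    congrEquiv_smul_of_eq hVW (absoluteGaloisGroup.toAlgEquiv K σ) P
  have h₃ : ∀ (σ : absoluteGaloisGroup K) (Q : V.geomPoints), e₃ (σ • Q) = σ • e₃ Q := by
    intro σ Q
    apply (VariableChange.pointEquivBaseChange W C (AlgebraicClosure K)).injective
    change VariableChange.pointEquivBaseChange W C (AlgebraicClosure K)
        ((VariableChange.pointEquivBaseChange W C (AlgebraicClosure K)).symm
          (Affine.Point.map ((absoluteGaloisGroup.toAlgEquiv K σ : _) :
            AlgebraicClosure K →ₐ[K] AlgebraicClosure K) Q)) =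
      VariableChange.pointEquivBaseChange W C (AlgebraicClosure K)
        (Affine.Point.map ((absoluteGaloisGroup.toAlgEquiv K σ : _) :
            AlgebraicClosure K →ₐ[K] AlgebraicClosure K)
          ((VariableChange.pointEquivBaseChange W C (AlgebraicClosure K)).symm Q))
    rw [AddEquiv.apply_symm_apply, VariableChange.pointEquivBaseChange_map_algEquiv,
      AddEquiv.apply_symm_apply]
  refine ⟨(e₁.trans e₂).trans e₃, fun σ hσ P ↦ ?_, fun σ hσ P ↦ ?_⟩
  · simp only [AddEquiv.trans_apply]
    rw [h₁, untwistEquiv_smul_of_eq V hd σ hσ (e₁ P), h₃]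
  · simp only [AddEquiv.trans_apply]
    rw [h₁, untwistEquiv_smul_of_eq_neg V hd σ hσ (e₁ P), map_neg, h₃]

/-- **`V_ℓ(E^{(d)}) ≅ V_ℓ(E) ⊗ χ_d`.**  For `d ≠ 0` and a homomorphism `χ : Γ_K → ℚ_ℓˣ` with
`χ(σ) = 1` when `σ√d = √d` and `χ(σ) = -1` when `σ√d = -√d` (the quadratic character of
`K(√d)/K`), there is a `ℚ_ℓ`-linear isomorphism `E : V_ℓ(E^{(d)}) ≃ V_ℓ(E)` with
`E (ρ_{E^{(d)}}(σ) x) = χ(σ) ρ_E(σ) (E x)`: the `ℓ`-adic representation of the quadratic twist is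
the twist of the `ℓ`-adic representation by the quadratic character.  Silverman, *AEC*, X.5
Cor. 5.4 with III.§7. [cite: SilvermanAEC2009, X.5 Cor. 5.4] -/
theorem exists_rationalTateModule_equiv_quadraticTwist (W : WeierstrassCurve K) {d : K}
    (hd : d ≠ 0) (p : ℕ) [Fact p.Prime] (χ : absoluteGaloisGroup K →* ℚ_[p]ˣ)
    (hχ₁ : ∀ σ : absoluteGaloisGroup K, σ • geomSqrt d = geomSqrt d → χ σ = 1)
    (hχ₂ : ∀ σ : absoluteGaloisGroup K, σ • geomSqrt d = -geomSqrt d → χ σ = -1) :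
    ∃ E : (W.quadraticTwist d).rationalTateModule p ≃ₗ[ℚ_[p]] W.rationalTateModule p,
      ∀ (σ : absoluteGaloisGroup K) (x : (W.quadraticTwist d).rationalTateModule p),
        E ((W.quadraticTwist d).rationalGaloisRepTate p σ x) =
          (χ σ : ℚ_[p]) • W.rationalGaloisRepTate p σ (E x) := by
  obtain ⟨f, hf₁, hf₂⟩ := W.exists_addEquiv_geomPoints_quadraticTwist_sign hd
  set s : absoluteGaloisGroup K → ℤˣ := fun σ ↦ if σ • geomSqrt d = geomSqrt d then 1 else -1
    with hs
  have hdich : ∀ σ : absoluteGaloisGroup K, ¬ σ • geomSqrt d = geomSqrt d →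
      σ • geomSqrt d = -geomSqrt d := fun σ h ↦
    (map_geomSqrt (absoluteGaloisGroup.toAlgEquiv K σ) d).resolve_left h
  obtain ⟨E, hE⟩ := exists_rationalTateModule_equiv_of_addEquiv p
    (MonoidHom.id (absoluteGaloisGroup K)) s f fun σ a ↦ by
      by_cases h : σ • geomSqrt d = geomSqrt d
      · rw [hs]
        simp only [h, if_true, Units.val_one, one_zsmul, MonoidHom.id_apply]
        exact hf₁ σ h a
      · rw [hs]
        simp only [h, if_false, Units.val_neg, Units.val_one, neg_smul, one_zsmul,
          MonoidHom.id_apply]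
        exact hf₂ σ (hdich σ h) a
  refine ⟨E, fun σ x ↦ ?_⟩
  change E (rationalTateRepresentation _ _ p (MonoidHom.id _ σ) x) =
    (χ σ : ℚ_[p]) • rationalTateRepresentation _ _ p σ (E x)
  rw [hE]
  congr 1
  by_cases h' : σ • geomSqrt d = geomSqrt d
  · rw [hs, hχ₁ σ h']
    simp [h']
  · rw [hs, hχ₂ σ (hdich σ h')]
    simp [h']

end Twist

end WeierstrassCurve
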